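import Mathlib
import Summits.Ventures.PercRepro2.TB14FlipFamily

/-!
# Row 2′TB: THE TWO EXTREME MEMBERS OF THE FLIP FAMILY ARE ADMISSIBLE (blind cell PercRepro2,
p5 g4, 2026-08-25; proofs/P5-RULES.md §1)

For a source `y` let `E_r := C_red(a₂) ∖ C_blue(a₂)` (the red-only region of `a₂`, containing
`o`). Every finite `Z ⊆ E_r` with `o ∈ Z` that is closed under red adjacency inside `E_r` carries a
red route from `o` to `C_blue(a₂)` (`route_of_redClosed`: explore `o`'s red component inside `Z`;
if it never meets `C_blue(a₂)` it is a red cluster avoiding it — impossible, `a₂` is red-connected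
to `o`). Hence
* `Z = E_r` is admissible — the map `ψ` (flip the whole red-only region), `isTgt_psi`;
* `Z =` the connected component of `o` in `H[E_r]` (edges of any colour) is admissible — the exact
  mirror of the component flip `φ` of P5-TB14.md §3, `isTgt_comp`.
Both are therefore kernel-checked maps from the sources of row 2′TB into its targets.
-/

namespace Summit.Ventures.PercRepro2

namespace TB14FlipFamily

open A3InactiveTyped

section Members

variable {V : Type} {E : Type} [Fintype V] [DecidableEq E]
variable (ends : E → Sym2 V) (a₁ a₂ b o : V) (F : Finset E)

open Classical in
/-- The red configuration restricted to the edges with both ends in `Z`. -/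
noncomputable def withinCfg (Z : Finset V) (y : Config E) : Config E :=
  fun e => if (∀ x ∈ ends e, x ∈ Z) then y e else false

open Classical in
/-- The configuration with every edge inside `Z` open (adjacency of any colour inside `Z`). -/
noncomputable def allWithin (Z : Finset V) : Config E :=
  fun e => if (∀ x ∈ ends e, x ∈ Z) then true else false

open Classical in
/-- The red-only region `E_r = C_red(a₂) ∖ C_blue(a₂)` as a finite set. -/
noncomputable def Er (y : Config E) : Finset V :=
  Finset.univ.filter fun v => Conn ends y a₂ v ∧ ¬ Conn ends (flipOn F y) a₂ v

open Classical in
/-- The connected component of `o` in `H[E_r]` (edges of any colour inside `E_r`). -/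
noncomputable def compO (y : Config E) : Finset V :=
  Finset.univ.filter fun v => Conn ends (allWithin ends (Er ends a₂ F y)) o v

/-- Membership in `E_r`. -/
lemma mem_Er {y : Config E} {v : V} :
    v ∈ Er ends a₂ F y ↔ Conn ends y a₂ v ∧ ¬ Conn ends (flipOn F y) a₂ v := by
  unfold Er; simp

/-- Membership in the component of `o`. -/
lemma mem_compO {y : Config E} {v : V} :
    v ∈ compO ends a₂ o F y ↔ Conn ends (allWithin ends (Er ends a₂ F y)) o v := by
  unfold compO; simp

omit [DecidableEq E] in
/-- Edges inside `Z` keep `Z`: anything reached from a vertex of `Z` through `allWithin Z` is in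
`Z`. -/
lemma mem_of_conn_allWithin {Z : Finset V} {v u : V} (hv : v ∈ Z)
    (h : Conn ends (allWithin ends Z) v u) : u ∈ Z := by
  have key : u ∈ {x : V | x ∈ Z} := by
    refine mem_of_conn_of_closed (ends := ends) (ω := allWithin ends Z) ?_ hv h
    intro x hx z hxz
    obtain ⟨_, e, he, hends⟩ := openGraph_adj.1 hxz
    unfold allWithin at he
    split_ifs at he with hin
    exact hin z (by rw [hends]; exact Sym2.mem_mk_right x z)
  exact key

omit [DecidableEq E] in
/-- An edge with both ends in `Z` is open in `allWithin Z`. -/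
lemma allWithin_of_ends {Z : Finset V} {e : E} {x u : V} (h : ends e = s(x, u)) (hx : x ∈ Z)
    (hu : u ∈ Z) : allWithin ends Z e = true := by
  unfold allWithin
  rw [if_pos]
  intro w hw
  rw [h, Sym2.mem_iff] at hw
  rcases hw with rfl | rfl
  · exact hx
  · exact hu

omit [DecidableEq E] in
/-- `withinCfg Z y ≤ routeCfg Z c y`. -/
lemma withinCfg_le_routeCfg (Z : Finset V) (c : V) (y : Config E) :
    withinCfg ends Z y ≤ routeCfg ends Z c y := by
  intro e
  unfold withinCfg routeCfg
  by_cases hin : ∀ x ∈ ends e, x ∈ Z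
  · rw [if_pos hin]
    by_cases hy : y e = true
    · have ht : Touch ends Z e :=
        ⟨(ends e).out.1, hin _ (Sym2.out_fst_mem (ends e)), Sym2.out_fst_mem (ends e)⟩
      rw [if_pos ⟨ht, fun x hx => Or.inl (hin x hx)⟩]
    · simp only [Bool.not_eq_true] at hy
      rw [hy]
      exact Bool.false_le _
  · rw [if_neg hin]
    exact Bool.false_le _

/-- **The route lemma.** A set `Z ⊆ E_r` containing `o` and closed under red adjacency inside `E_r`
carries a red route from `o` to `C_blue(a₂)` in the sense of (Z1). -/
lemma route_of_redClosed {Z : Finset V} {y : Config E} (hs : IsSrc ends a₁ a₂ b o F y)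
    (hsub : ∀ v ∈ Z, Conn ends y a₂ v ∧ ¬ Conn ends (flipOn F y) a₂ v) (hoZ : o ∈ Z)
    (hcl : ∀ v ∈ Z, ∀ u, (∃ e, y e = true ∧ ends e = s(v, u)) → ¬ Conn ends (flipOn F y) a₂ u →
      u ∈ Z) :
    ∃ c, Conn ends (flipOn F y) a₂ c ∧ Conn ends (routeCfg ends Z c y) o c := by
  by_contra hno
  simp only [not_exists, not_and] at hno
  -- the red component of `o` inside `Z` never meets `C_blue(a₂)`: then it is closed under red
  -- adjacency, hence contains `a₂ ∈ C_blue(a₂)` — contradiction.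
  have hZ : ∀ u, Conn ends (withinCfg ends Z y) o u → u ∈ Z := by
    intro u hu
    have key : u ∈ {x : V | x ∈ Z} := by
      refine mem_of_conn_of_closed (ends := ends) (ω := withinCfg ends Z y) ?_ hoZ hu
      intro x hx z hxz
      obtain ⟨_, e, he, hends⟩ := openGraph_adj.1 hxz
      unfold withinCfg at he
      split_ifs at he with hin
      exact hin z (by rw [hends]; exact Sym2.mem_mk_right x z)
    exact key
  have hclosed : ∀ u, Conn ends (withinCfg ends Z y) o u → ∀ z, (openGraph ends y).Adj u z →
      Conn ends (withinCfg ends Z y) o z := by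
    intro u hu z huz
    obtain ⟨_, e, he, hends⟩ := openGraph_adj.1 huz
    have huZ : u ∈ Z := hZ u hu
    -- `z` is not in `C_blue(a₂)`: otherwise `o → u → z` is a route
    have hz' : ¬ Conn ends (flipOn F y) a₂ z := by
      intro hz
      apply hno z hz
      have h₁ : Conn ends (routeCfg ends Z z y) o u :=
        conn_mono (withinCfg_le_routeCfg ends Z z y) hu
      have h₂ : routeCfg ends Z z y e = true := by
        unfold routeCfg
        rw [if_pos]
        · exact he
        · refine ⟨touch_of_ends ends hends huZ, ?_⟩
          intro x hx
          rw [hends, Sym2.mem_iff] at hx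
          rcases hx with rfl | rfl
          · exact Or.inl huZ
          · exact Or.inr rfl
      exact conn_trans h₁ (conn_of_openAdj ⟨e, h₂, hends⟩)
    have hzZ : z ∈ Z := hcl u huZ z ⟨e, he, hends⟩ hz'
    have hw : withinCfg ends Z y e = true := by
      unfold withinCfg
      rw [if_pos]
      · exact he
      · intro x hx
        rw [hends, Sym2.mem_iff] at hx
        rcases hx with rfl | rfl
        · exact huZ
        · exact hzZ
    exact conn_trans hu (conn_of_openAdj ⟨e, hw, hends⟩)
  -- so `a₂`, red-connected to `o`, lies in the red component of `o` inside `Z`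
  have ha₂ : Conn ends (withinCfg ends Z y) o a₂ := by
    have key : a₂ ∈ {x : V | Conn ends (withinCfg ends Z y) o x} :=
      mem_of_conn_of_closed (ends := ends) (ω := y) (fun x hx z hxz => hclosed x hx z hxz)
        (conn_refl _ _ _) (conn_symm hs.ho)
    exact key
  exact (hsub a₂ (hZ a₂ ha₂)).2 (conn_refl ends _ a₂)

/-- **`ψ` is admissible**: the whole red-only region `E_r`. -/
theorem admissible_Er {y : Config E} (hs : IsSrc ends a₁ a₂ b o F y) :
    Admissible ends a₁ a₂ o F (Er ends a₂ F y) y := by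
  have hsub : ∀ v ∈ Er ends a₂ F y, Conn ends y a₂ v ∧ ¬ Conn ends (flipOn F y) a₂ v :=
    fun v hv => (mem_Er ends a₂ F).1 hv
  have hoZ : o ∈ Er ends a₂ F y := (mem_Er ends a₂ F).2 ⟨hs.ho, hs.ho'⟩
  refine ⟨hsub, hoZ, ?_, ?_, ?_⟩
  · refine route_of_redClosed ends a₁ a₂ b o F hs hsub hoZ ?_
    intro v hv u ⟨e, he, hends⟩ hu'
    exact (mem_Er ends a₂ F).2 ⟨conn_trans (hsub v hv).1 (conn_of_openAdj ⟨e, he, hends⟩), hu'⟩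
  · intro v _ u _ hu hu'
    exact (mem_Er ends a₂ F).2 ⟨hu, hu'⟩
  · intro v hv u ⟨e, he, hends⟩ hu
    refine (mem_Er ends a₂ F).2 ⟨conn_trans (hsub v hv).1 (conn_of_openAdj ⟨e, he, hends⟩), ?_⟩
    intro h
    exact hs.q₂ (conn_trans hu (conn_symm h))

/-- **The flip `ψ` of the red-only region sends a source to a target** (kernel form of the mirror
of P5-TB14.md §3's «into» lemma). -/
theorem isTgt_psi (hF : ∀ e, e ∈ F) {y : Config E} (hs : IsSrc ends a₁ a₂ b o F y) :
    IsTgt ends a₁ a₂ b o F (starFlip ends (Er ends a₂ F y) y) :=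
  isTgt_starFlip ends a₁ a₂ b o F hF hs (admissible_Er ends a₁ a₂ b o F hs)

/-- **The component of `o` in `H[E_r]` is admissible** (the mirror of the component flip `φ`). -/
theorem admissible_compO {y : Config E} (hs : IsSrc ends a₁ a₂ b o F y) :
    Admissible ends a₁ a₂ o F (compO ends a₂ o F y) y := by
  have hoE : o ∈ Er ends a₂ F y := (mem_Er ends a₂ F).2 ⟨hs.ho, hs.ho'⟩
  have hsub : ∀ v ∈ compO ends a₂ o F y, Conn ends y a₂ v ∧ ¬ Conn ends (flipOn F y) a₂ v := by
    intro v hv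
    exact (mem_Er ends a₂ F).1 (mem_of_conn_allWithin ends hoE ((mem_compO ends a₂ o F).1 hv))
  have hoZ : o ∈ compO ends a₂ o F y := (mem_compO ends a₂ o F).2 (conn_refl _ _ _)
  -- a vertex of `E_r` adjacent (by an edge of any colour) to the component lies in it
  have hadj : ∀ v ∈ compO ends a₂ o F y, ∀ u, ∀ e, ends e = s(v, u) → u ∈ Er ends a₂ F y →
      u ∈ compO ends a₂ o F y := by
    intro v hv u e hends hu
    have hvE : v ∈ Er ends a₂ F y := mem_of_conn_allWithin ends hoE ((mem_compO ends a₂ o F).1 hv)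
    refine (mem_compO ends a₂ o F).2 (conn_trans ((mem_compO ends a₂ o F).1 hv)
      (conn_of_openAdj ⟨e, allWithin_of_ends ends hends hvE hu, hends⟩))
  refine ⟨hsub, hoZ, ?_, ?_, ?_⟩
  · refine route_of_redClosed ends a₁ a₂ b o F hs hsub hoZ ?_
    intro v hv u ⟨e, he, hends⟩ hu'
    exact hadj v hv u e hends
      ((mem_Er ends a₂ F).2 ⟨conn_trans (hsub v hv).1 (conn_of_openAdj ⟨e, he, hends⟩), hu'⟩)
  · intro v hv u ⟨e, _, hends⟩ hu hu'
    exact hadj v hv u e hends ((mem_Er ends a₂ F).2 ⟨hu, hu'⟩)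
  · intro v hv u ⟨e, he, hends⟩ hu
    refine hadj v hv u e hends ((mem_Er ends a₂ F).2
      ⟨conn_trans (hsub v hv).1 (conn_of_openAdj ⟨e, he, hends⟩), ?_⟩)
    intro h
    exact hs.q₂ (conn_trans hu (conn_symm h))

/-- **The component flip sends a source to a target**: flipping the stars of the connected component
of `o` in `H[E_r]`. -/
theorem isTgt_comp (hF : ∀ e, e ∈ F) {y : Config E} (hs : IsSrc ends a₁ a₂ b o F y) :
    IsTgt ends a₁ a₂ b o F (starFlip ends (compO ends a₂ o F y) y) :=
  isTgt_starFlip ends a₁ a₂ b o F hF hs (admissible_compO ends a₁ a₂ b o F hs)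

end Members

end TB14FlipFamily

end Summit.Ventures.PercRepro2
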